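import Mathlib
import HarnessLib
import HarnessLib.Audit
import Summits.HodgeConjecture.HodgeConjecture.Statement
import Literature.AlgebraicGeometry.HodgeTheory.HodgeConjecture
import Literature.AlgebraicGeometry.Motives.AbelianVarietyProduct
import Literature.AlgebraicGeometry.Motives.CartierDivisorClassPullback
import Literature.AlgebraicGeometry.Motives.CartierDivisorEffective
import Literature.Barriers.HodgeConjecture.ExceptionalHodgeClasses

/-!
Route: DegreeSpectroscopy

CLOSED (retired) 2026-08-15T13:48:12Z by operator:999:1257524 — reason: not-a-thesis: assembly does not conclude the sub-problem Statement — note: D-0027 §2.1 audit (human 2026-08-15: routes that do not decide the summit are removed): the assembly concludes `WeilClassesAlgebraic`, not the sub-problem statement; a NEW conforming route may be opened from the same idea (generated `closes : … → _root_.HodgeConjecture`).. The file is kept as the record of this route; refuted decls are indexed as negative knowledge (`ledger negatives`).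

Route DegreeSpectroscopy — "cycles must not escape to infinity along a Hecke orbit" (idea card
degree-spectroscopy-hecke-orbit).

THESIS X (words). Fix an imaginary quadratic field K = Q(sqrt(-d)), a half-dimension n >= 1 and
polarization degrees. Inside every split-discriminant family S(K, n, type) of polarized abelian
2n-folds of Weil type sits the K-isogeny (Hecke) orbit of the SPLIT SQUARES B0 x B0 (dim B0 = n, K
acting through M_2(Q) by (x,y) |-> (m x - d y, x + m y), compatible product polarization pr1^* P_B +
d pr2^* P_B): a countable, Zariski-dense set of explicit arithmetic varieties (B0 x B0)/G on each of
which the Weil classes ARE algebraic (at a square they are polynomials in three divisor classes;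
isogenies transport algebraicity) — but by cycles whose degree grows like deg(G)^(1/2). X says:
there is M = M(n, K, generator, h^0(P_B), h^0(P)) such that at EVERY point (A, K, P) of that orbit
the rational Weil classes of A lie in the span of classes supported on proper intersections D_1 cap
... cap D_n of members D_i of the linear systems |k P|, k <= M — i.e. they are spanned by classes of
subvarieties of UNIFORMLY BOUNDED P-degree ("B_min is bounded along the orbit").

WHY IT SUFFICES. The locus D_M of points of S where the (flat) Weil classes lie in the bounded span
is Zariski closed (proper relative Chow schemes of bounded degree + local constancy of cycle
classes); it contains the dense orbit, so D_M = S: the Weil classes are algebraic on every abelian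
variety of split Weil type (all K, all n, all polarization types); Schoen's surface-product trick (A
x Weil surface of complementary discriminant is split) then gives every discriminant. Conversely the
Hodge conjecture implies X (Baire over the finitely many components with fixed invariants). So X is
EQUIVALENT to the target and converts it into DEGREE SPECTROSCOPY at arithmetic points: an a-priori
bound for an integer-valued invariant on countably many explicit abelian varieties, with no Hodge
theory and no deformation theory left in the statement, and with a refutation branch (divergence of
B_min along an isogeny tower = not HC, without ever exhibiting a non-algebraic class on one
variety).

TARGET (sector, rank 0) = decl WeilClassesAlgebraic: for every complex abelian variety A of
dimension 2n and every endomorphism f with f^2 - a f + b = 0, a^2 < 4b, generic ((sigma/sigma-bar)^j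
!= 1 for j <= 2n), every rational Hodge (n,n)-class in the Weil eigen-part E_{f^*}(sigma^{2n}) +
E_{f^*}(sigma-bar^{2n}) of H^{2n}(A(C); C) (= Lambda^{2n}_K H^1 tensor C) lies in
Literature.AlgebraicGeometry.HodgeTheory.algebraicClasses A.X n. Known for 2n <= 4 (all K, all
discriminants) and for sixfolds of split type (Schoen, van Geemen, Koike, Markman 2025); open for
sixfolds of non-split discriminant and for 2n >= 8 (Weil 1977). The assembly ENDS at this sector
target; X -> HodgeConjecture is not claimed (Andre's CM reduction needs Weil classes for CM FIELDS
of higher degree, Charles–Schnell Thm 11.5.21; the same mechanism applies there with anchors B0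
tensor E but is not typed in this route).

X as a Lean Prop = decl HeckeOrbitDegreeBound of the route file (one line, ~2.9 k chars),
schematically:
  forall (n m d t t' : Nat), 1 <= n -> 1 <= d -> Generic(2m, m^2+d, n) -> exists M, forall (B0 :
AbelianVariety C) (PB : CartierDivisor B0.X.left), B0.dim = n -> PB.IsAmple -> PB.IsEffective ->
PB.h0 C = t -> forall (A) (g : B0.prod B0 --> A) (f : A --> A) (P : CartierDivisor A.X.left) (N :
Nat), IsIsogeny g -> 1 <= N -> comp fsplit g = comp g f -> P.IsAmple -> P.IsEffective -> P.h0 C = t'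
-> (P.pullback g).LinEquiv (N • (PB.pullback fst + d • PB.pullback snd)) -> forall c :
H^{2n}(A(C);C), IsRationalClass c -> c in WeilPart(f) -> c in Sup_{D : Fin n -> CartierDivisor
A.X.left, D i effective, D i ~ k_i P, k_i <= M, cap supp(D i) of codim >= n} ker (H^{2n}(A) ->
H^{2n}(A minus cap supp D_i))
over Literature.AlgebraicGeometry.Motives.{AbelianVariety,
CartierDivisor(.IsAmple/.IsEffective/.LinEquiv/.pullback/.h0/.Avoids), AlgPoints.mapContinuous,
ComplexPoints}, Literature.AlgebraicTopology.SingularHomology.singularCohomology(.map),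
Literature.AlgebraicGeometry.HodgeTheory.{complexBetti.restrictCompl, IsRationalClass,
IsOfHodgeType, algebraicClasses}, Module.End.eigenspace — all existing declarations; every item of
the route elaborates (planner Sketch.lean, rc 0).

Rationale: WHY THIS LINE. Deligne's proof that Hodge classes on abelian varieties are absolute (LNM 900, Thm
4.8/§5; Charles–Schnell §11.5) already uses the split squares A0 (x) K as ANCHORS where Weil classes
are algebraic, and transports absoluteness along the Weil family by Principle B (flat deformation).
Algebraicity has no Principle B; this route replaces it by COMPACTNESS: bounded-degree algebraicity
loci are Zariski closed (proper relative Chow; the CDK circle, Voisin's Hodge-loci survey), the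
K-isogeny orbit of the anchors is Zariski dense in every split-discriminant family (components with
the same (K,n,delta) parametrise isogenous varieties [vanGeemen1994HodgeAV §5;
Markman2025SurveySecant §11.5]; U(n,n)(Q) dense in U(n,n)(R)), so Weil-class algebraicity on the
whole family is EQUIVALENT to a uniform degree bound along ONE countable orbit of explicit
arithmetic varieties (B0 x B0)/G. Imported areas: arithmetic of Hecke/isogeny graphs and of
Neron–Severi lattices (reduction theory), degree lower-bound technology for subvarieties of abelian
varieties (Debarre; tropical/matroidal, arXiv:2507.15704), theta/Heisenberg and secant-sheaf
constructions (van Geemen, Markman) as upper-bound engines. Typed without intersection theory: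
"degree <= B" is rendered by the support-kernel device of algebraicClasses on proper intersections
of members of |kP|, k <= M (Mumford: a subvariety of degree delta is a component of a proper
intersection of degree-delta hypersurface sections).
RANKED CRUXES. r2 HeckeOrbitDegreeBound (= X; first open case 2n = 8; equivalent to the target
modulo folklore glue). r3 DivisorialDegreeBound: the arithmetic sharpening — along the orbit the
Weil line lies INSIDE the divisor ring (it does at B0 x B0 by the FFT for Sp, and g^* is a ring
isomorphism preserving NS_Q), and r3 asks for bounded divisor monomials (irreducible proper
intersections of sub-|MP| effective divisors); NOT implied by HC, decidable in principle by lattice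
arithmetic along the orbit, informative either way (true => target by pure arithmetic; false => deep
bounded cycles must be non-divisorial, the shape a uniform construction must have). r4
IsogenyTowerDegreeGrowth = not r2: the refutation branch (divergence of B_min along an isogeny tower
<=> Weil-class algebraicity fails somewhere <=> not HC), immune to the absolute-Hodge/motivated
no-gos because it never exhibits a class on one variety; must use n >= 4 (false for 2n <= 6).
SUPPORT (provable from print, staff when idle): SplitSquareAnchors (W_K subset D^n at squares: det
H^1(B0) (x) K is SL-invariant; FFT for Sp gives theta1, theta2, m^*theta), SplitSquareAnchorsBounded
(uniform degree at depth N = 1), FourfoldOrbitBound (n = 2 calibration: non-effective M from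
Markman/Schoen + Baire; the EFFECTIVE M at the first deep points of van Geemen's Q(i) family is the
card's computation G3 — attach kit jobs there), DivisorialToGeneral (r3 -> r2),
DivisorialDegreeGrowth (not r3; expected provable, first experiment n = 1: ternary forms),
HeckeOrbitGlue (r2 -> target: compactness + density + isogeny transport + Schoen's surface-product
trick + generic generators), Assembly (modus ponens; ends at the sector target).
KILL CRITERIA. (i) A proof of r4 (or of divergence in one explicit tower) closes the POS line and is
filed as a refutation of HodgeConjecture; (ii) a refuter showing that the typed complexity measure
is not cofinal with P-degree (e.g. that components of proper intersections of |kP|-members miss some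
bounded-degree subvarieties on abelian varieties) forces a restatement of r2/r3, not a close; (iii)
if DivisorialDegreeGrowth is proved AND a uniform non-divisorial construction is out of reach for n
= 4 after the dimension-4 calibration data are in, demote to dormant; (iv) superseded if a
semiregularity/secant route proves WeilClassesAlgebraic for 2n = 8 directly.
NOT DECOMPOSED YET. Prime depth (N prime suffices by equidistribution of Hecke translates,
Clozel–Oh–Ullmo type) as the first split of r2; the CM-field version (anchors B0 (x) E, unitary
Shimura varieties for E/F) which together with Andre's theorem [CharlesSchnell2014Notes Thm 11.5.21;
Markman2025SurveySecant Thm 1.4] would upgrade the target to HC for CM abelian varieties; the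
one-step propagation lemma across a single prime isogeny; explicit low-degree rigidity statements on
(B0 x B0)/G for the NEG side.

Novelty: NEAREST PRIOR ART. (1) Deligne1982HodgeCycles Thm 4.8/§5 = CharlesSchnell2014Notes Thm 11.5.24: the
SAME anchors A0 (x) K inside the split Weil family, used with Principle B for absolute Hodge
classes; (2) folklore "HC on a Hodge-locus component <=> a uniform degree bound" via proper relative
Chow + Baire (Voisin's Hodge-loci survey; CattaniDeligneKaplan1995JAMS); (3) isogeny invariance +
density of the isogeny class and the discriminant/split dictionary (vanGeemen1994HodgeAV §5,
Markman2025SurveySecant §11.5, Deligne–Milne); (4) degree lower bounds (Debarre; arXiv:2507.15704,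
integral) and uniform theta/secant constructions (vanGeemen1994HodgeAV 4.16, Markman2025SecantWeil)
as the two engines; (5) arXiv:2603.20268 (CM points on the Weil locus of sixfolds via Andre–Oort:
special points, different mechanism).
DELTA. Principle B is replaced by compactness + a uniform degree bound along the dense isogeny orbit
of Deligne's anchors, turning Weil-class algebraicity (all K, all 2n, all discriminants via Schoen's
product trick) into a bound for one integer invariant on countably many explicit arithmetic abelian
varieties; TYPED over the tree without intersection theory (support-kernel spans on proper
intersections of |kP|-members); a DIVISORIAL sharpening (the Weil line sits inside the divisor ring
at every orbit point — new observation here — so a lattice-arithmetic toy exists) and a two-sided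
programme (divergence along an isogeny tower as a counterexample mechanism that never nam  [refs: 2507.15704, 2603.20268, 2308.13913, GreenMurreVoisin1994]

Barriers (technique_class: chow-compactness, degree-bounds, hecke-density, weil-classes): technique_class: chow-compactness, degree-bounds, hecke-density, weil-classes
- Literature.Barriers.HodgeConjecture.Andre1996_hodgeClassesOnAbelianVarieties_motivated: the POS
side (r2, r3) constructs/bounds cycles and is untouched; the NEG side (r4) is a divergence statement
along a tower — it exhibits no Hodge class on a single abelian variety, so motivated-ness of each
Weil class is consistent with it; the price (a success of r4 gives not-B(X) for an auxiliary X by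
Andre 0.6.2, cf. not_hodgeCounterexampleOnAbelianVariety_of_lefschetzStandardConjecture) is stated
in r4's docstring.
- Literature.Barriers.HodgeConjecture.hodgeClassesAreAbsoluteFor_abelianVariety: no Galois or
conjugation test is used; Weil classes at every orbit point are algebraic anyway (isogeny
transport), the question is only their degree — a quantity the absolute-Hodge property does not see.
- Literature.Barriers.HodgeConjecture.Weil1977_exceptionalHodgeClasses and
Literature.Barriers.HodgeConjecture.Mumford1968_simpleFourfold_exceptionalHodgeClasses: the targeted
classes ARE the exceptional ones; divisor classes are used only (a) as the ballast P^n / linear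
systems |kP| measuring complexity and (b) POINTWISE at orbit points, where NS has rank 3 and the
Weil line provably lies in the divisor ring (r3) — never at the generic point where B^1 = Q; the
passage to the generic point is by compactness, not by generation in degree two.
- Literature.Barriers.HodgeConjecture.CattaniDeligneKaplan1995_hodgeLocus_alg

History (route lifecycle, newest last):
- 2026-08-15T13:48:13Z · CLOSED retired — not-a-thesis: assembly does not conclude the sub-problem Statement (operator:999:1257524)

sub-problem: HodgeConjecture · status: closed(retired) · opened planner-plancard-HodgeConjecture-HodgeConject-084f5d2e-0 2026-08-15T11:11:50Z · rev 1 · ledger route-HodgeConjecture-DegreeSpectroscopy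
GENERATED by the gate from the ledger (D-0016/17). Provers cite these decls: `theorem foo : Summit.HodgeConjecture.HodgeConjecture.Theses.DegreeSpectroscopy.<Decl> := …` in Summits/HodgeConjecture/HodgeConjecture/Theorems/<Name>.lean.
-/

namespace Summit.HodgeConjecture.HodgeConjecture.Theses.DegreeSpectroscopy

open scoped BigOperators Topology Manifold Classical MeasureTheory ProbabilityTheory Matrix InnerProductSpace ComplexConjugate ContinuousMap
open Filter Set Function TopologicalSpace MeasureTheory

attribute [summit_statement] _root_.HodgeConjecture

/-- item stmt-HodgeConjecture-3141 · target · rank 0 · closed · moot by None · by planner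
why it might fail: Weil (1977) expected a counterexample here; still open for all 2n >= 8 and for sixfolds of non-split discriminant (arXiv:2603.20268 §1); every success (Prym covers, theta identities, generalized Kummers, OG6, secant sheaves + semiregularity) is dimension-specific and stops at 2n = 6.
sources: Weil1977HodgeRing, vanGeemen1994HodgeAV Def 4.9, Lemma 5.2, Thm 4.11, 6.12, Schoen1988HodgeWeil, Markman2025SurveySecant Thm 1.2, Cor 1.3, §1.1, §11.5 (arXiv:2509.23403), Markman2025SecantWeil (arXiv:2502.03415), arXiv:2603.20268 §1 (status 2026: non-split sixfolds and 2n >= 8 open)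
[target] WEIL 1977 (sector target of the route). For every complex abelian variety A of dimension 2n
and every endomorphism f generating an imaginary quadratic field K = Q(f) (f^2 - a f + b = 0 in End
A, a^2 < 4b) with GENERIC generator ((sigma/sigma-bar)^j != 1 for 1 <= j <= 2n, so that the extreme
eigenvalues sigma^{2n}, sigma-bar^{2n} of f^* on H^{2n} = Lambda^{2n} H^1 cut out exactly
Lambda^{2n} V_sigma + Lambda^{2n} V_sigma-bar = W_K tensor C), every RATIONAL class of HODGE TYPE
(n,n) in that eigen-sum is algebraic (in algebraicClasses A.X n = classes supported in codimension
n). For (A,K) of Weil type (n,n) these are all of W_K = Lambda^{2n}_K H^1(A,Q) (van Geemen 4.9,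
5.2.6); for other signatures W_K has no non-zero Hodge class, so nothing is asked. Known: 2n <= 4
all K and discriminants, 2n = 6 split discriminant (Schoen, van Geemen, Koike, Markman 2025:
Markman2025SurveySecant Thm 1.2); OPEN: sixfolds of non-split discriminant, all 2n >= 8. The
assembly ends here: X -> HodgeConjecture is NOT claimed (HC outside the Weil sector is out of scope;
Andre's reduction of CM-type HC needs Weil classes for CM FIELDS, CharlesSchnell2014Notes Thm
11.5.21). -/
@[route_item "route-HodgeConjecture-DegreeSpectroscopy"]
def WeilClassesAlgebraic : Prop :=
  ∀ (A : Literature.AlgebraicGeometry.Motives.AbelianVariety ℂ) (n : ℕ) (f : A ⟶ A) (a b : ℤ), A.dim = 2 * n → 1 ≤ n → CategoryTheory.CategoryStruct.comp f f - a • f + b • CategoryTheory.CategoryStruct.id A = 0 → a * a < 4 * b → (∀ w₁ w₂ : ℂ, w₁ ^ 2 - ((a : ℤ) : ℂ) * w₁ + ((b : ℤ) : ℂ) = 0 → w₂ ^ 2 - ((a : ℤ) : ℂ) * w₂ + ((b : ℤ) : ℂ) = 0 → w₁ ≠ w₂ → ∀ j : ℕ, 0 < j → j ≤ 2 * n → w₁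 ^ j ≠ w₂ ^ j) → ∀ c : Literature.AlgebraicTopology.SingularHomology.singularCohomology ℂ ℂ (Literature.AlgebraicGeometry.Motives.ComplexPoints A.X) (2 * n), Literature.AlgebraicGeometry.HodgeTheory.IsRationalClass c → Literature.AlgebraicGeometry.HodgeTheory.IsOfHodgeType (2 * n) A.X (2 * n) n n c → c ∈ ⨆ (w : ℂ) (_ : w ^ 2 - ((a : ℤ) : ℂ) * w + ((b : ℤ) : ℂ) = 0), Module.End.eigenspace ((Literature.AlgebraicTopology.SingularHomology.singularCohomology.map ℂ ℂ (Literature.AlgebraicGeometry.Motives.AlgPoints.mapContinuous (L := ℂ) (f).hom.hom.hom) (2 * n)).hom) (w ^ (2 * n)) → c ∈ Literature.AlgebraicGeometry.HodgeTheory.algebraicClasses A.X n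

/-- item stmt-HodgeConjecture-3142 · crux · rank 2 · closed · moot by None · by planner
why it might fail: Equivalent (mod Chow compactness + Hecke density) to algebraicity of Weil classes in split type, open for 2n >= 8 (Weil 1977); all uniform constructions (Schoen, van Geemen, Markman) stop at 2n = 6, and cycles transported along g have degree ~ deg(g)^(1/2): bounded deep cycles must be new.
sources: Weil1977HodgeRing, vanGeemen1994HodgeAV §5 (5.12), 4.16, Deligne1982HodgeCycles Thm 4.8, §5 (anchors A0 (x) K), CharlesSchnell2014Notes Thm 11.5.24, Markman2025SurveySecant Thm 1.2, §11.5 Steps 1-2 (arXiv:2509.23403), Voisin2007HodgeLoci (loci of bounded-degree algebraic classes are closed algebraic; Baire)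
[crux] THESIS X — CYCLES DO NOT ESCAPE TO INFINITY ALONG THE ISOGENY ORBIT. Data: n >= 1; K =
Q(sqrt(-d)) with generic generator m + sqrt(-d) (a = 2m, b = m^2 + d); polarization degrees t =
h^0(P_B), t' = h^0(P). Claim: there is M = M(n,m,d,t,t') such that for EVERY split square B0 x B0
(dim B0 = n; K acting by fsplit = prodLift(m fst - d snd)(fst + m snd), i.e. (x,y) |-> (m x - d y, x
+ m y); compatible product polarization Theta0 = fst^*P_B + d snd^*P_B — van Geemen 4.9:
(sqrt(-d))^*E = dE) and EVERY K-equivariant isogeny g : B0 x B0 -> A (fsplit ; g = g ; f) with an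
effective ample P on A, h^0(P) = t', g^*P ~ N Theta0 (any similitude level N >= 1: this sweeps the
Hecke/isogeny orbit of the split locus, Zariski dense in every component of the split-discriminant
Weil families S(K,n,type); for generic B0 every K-compatible polarization pulls back to a multiple
of Theta0, and translating P fixes the linear class), every rational class in the Weil eigen-part of
f^* on H^{2n}(A(C);C) lies in the span of the kernels ker(H^{2n}(A) -> H^{2n}(A minus Z)) over Z =
supp D_1 cap ... cap supp D_n of codimension >= n with D_i effective, D_i ~ k_i P, k_i <= M. That
span = C-span of the classes -/
@[route_item "route-HodgeConjecture-DegreeSpectroscopy"]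
def HeckeOrbitDegreeBound : Prop :=
  ∀ (n m d t t' : ℕ), 1 ≤ n → 1 ≤ d → (∀ w₁ w₂ : ℂ, w₁ ^ 2 - ((2 * (m : ℤ) : ℤ) : ℂ) * w₁ + (((m : ℤ) ^ 2 + (d : ℤ) : ℤ) : ℂ) = 0 → w₂ ^ 2 - ((2 * (m : ℤ) : ℤ) : ℂ) * w₂ + (((m : ℤ) ^ 2 + (d : ℤ) : ℤ) : ℂ) = 0 → w₁ ≠ w₂ → ∀ j : ℕ, 0 < j → j ≤ 2 * n → w₁ ^ j ≠ w₂ ^ j) → ∃ M : ℕ, ∀ (B₀ : Literature.AlgebraicGeometry.Motives.AbelianVariety ℂ) (PB : Literature.AlgebraicGeometry.Motives.CartierDivisor B₀.X.left) [AlgebraicGeometry.IsDominant (Literature.AlgebraicGeometry.Motives.AbelianVariety.Hom.toSchemeHom (Literature.AlgebraicGeometry.Motives.AbelianVariety.fst B₀ B₀))] [AlgebraicGeometry.IsDominant (Literature.AlgebraicGeometry.Motives.AbelianVariety.Hom.toSchemeHom (Literature.AlgebraicGeometry.Motives.AbelianVariety.snd B₀ B₀))], B₀.dim = n → PB.IsAmple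 → PB.IsEffective → PB.h0 ℂ = t → ∀ (A : Literature.AlgebraicGeometry.Motives.AbelianVariety ℂ) (g : B₀.prod B₀ ⟶ A) (f : A ⟶ A) (P : Literature.AlgebraicGeometry.Motives.CartierDivisor A.X.left) (N : ℕ) [AlgebraicGeometry.IsDominant (Literature.AlgebraicGeometry.Motives.AbelianVariety.Hom.toSchemeHom g)], Literature.AlgebraicGeometry.Motives.AbelianVariety.IsIsogeny g → 1 ≤ N → CategoryTheory.CategoryStruct.comp (Literature.AlgebraicGeometry.Motives.AbelianVariety.prodLift ((m : ℤ) • Literature.AlgebraicGeometry.Motives.AbelianVariety.fst B₀ B₀ - ((d : ℕ) : ℤ) • Literature.AlgebraicGeometry.Motives.AbelianVariety.snd B₀ B₀) (Literature.AlgebraicGeometry.Motives.AbelianVariety.fst B₀ B₀ + (m : ℤ) • Literature.AlgebraicGeometry.Motives.AbelianVariety.snd B₀ B₀)) g = CategoryTheory.CategoryStruct.comp g f → P.IsAmple → P.IsEffective → P.h0 ℂ = t' → (P.pullback (Literature.AlgebraicGeometry.Motives.AbelianVariety.Hom.toSchemeHom g)).LinEquiv (N • (PB.pullback (Literature.AlgebraicGeometry.Motives.AbelianVariety.Hom.toSchemeHom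 (Literature.AlgebraicGeometry.Motives.AbelianVariety.fst B₀ B₀)) + (d) • PB.pullback (Literature.AlgebraicGeometry.Motives.AbelianVariety.Hom.toSchemeHom (Literature.AlgebraicGeometry.Motives.AbelianVariety.snd B₀ B₀)))) → ∀ c : Literature.AlgebraicTopology.SingularHomology.singularCohomology ℂ ℂ (Literature.AlgebraicGeometry.Motives.ComplexPoints (A).X) (2 * n), Literature.AlgebraicGeometry.HodgeTheory.IsRationalClass c → c ∈ ⨆ (w : ℂ) (_ : w ^ 2 - ((2 * (m : ℤ) : ℤ) : ℂ) * w + (((m : ℤ) ^ 2 + (d : ℤ) : ℤ) : ℂ) = 0), Module.End.eigenspace ((Literature.AlgebraicTopology.SingularHomology.singularCohomology.map ℂ ℂ (Literature.AlgebraicGeometry.Motives.AlgPoints.mapContinuous (L := ℂ) (f).hom.hom.hom) (2 * n)).hom) (w ^ (2 * n)) → c ∈ ⨆ (D : Fin (n) → Literature.AlgebraicGeometry.Motives.CartierDivisor (A).X.left) (_ : ∀ i, (D i).IsEffective ∧ ∃ k : ℕ, k ≤ M ∧ (D i).LinEquiv (k • P)) (_ : ∀ z ∈ {z | ∀ i,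 ¬ (D i).Avoids z}, ((n : ℕ) : ℕ∞) ≤ Order.coheight z), LinearMap.ker (Literature.AlgebraicGeometry.HodgeTheory.complexBetti.restrictCompl (A).X {z | ∀ i, ¬ (D i).Avoids z} (2 * n)).hom

/-- item stmt-HodgeConjecture-3143 · crux · rank 3 · closed · moot by None · by planner
why it might fail: Not implied by HC: along the orbit NS_Q keeps rank 3 while disc(NS) grows with N; spanning W_K by IRREDUCIBLE set-theoretic intersections of sub-|MP| divisors is a lattice-Diophantine condition the opener expects to fail at deep points already for n <= 2 (Kani ternary forms; van Geemen Q(i) family).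
sources: vanGeemen1994HodgeAV 6.12, §7, GoodmanWallachGTM255 (FFT for Sp; skew Howe duality), LangeBirkenhake1992 (NS of products; Riemann-Roch on abelian varieties), Kani2014 (NS lattices of surfaces isogenous to E1 x E2 as ternary quadratic forms), doi:10.1007/bf02567454 (Kani 1994, Elliptic curves on abelian surfaces: curves of given degree <-> NS classes), Deligne1982HodgeCycles §4
[crux] DIVISORIAL SHARPENING OF X (the arithmetic toy). Observation: at EVERY orbit point A the Weil
space lies INSIDE the Q-algebra generated by divisor classes — at B0 x B0, W_K =
Lambda^{2n}_K(H^1(B0) (x) K) = det H^1(B0) (x) K is SL(H^1(B0))-invariant, hence (first fundamental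
theorem for Sp / skew Howe duality) a polynomial in the three degree-2 invariants theta1 = fst^*,
theta2 = snd^*, mu (addition map), all classes of line bundles; and g^* : H^*(A,Q) -> H^*(B0 x B0,Q)
is a ring isomorphism carrying NS_Q onto NS_Q — but through monomials whose P-degree grows along the
orbit. Statement (same quantifiers as X): uniformly on the orbit the rational Weil classes lie in
the span of ker(H^{2n}(A) -> H^{2n}(A minus Z)) over IRREDUCIBLE proper intersections Z = supp E_1
cap ... cap supp E_n of effective divisors E_i that are sub-divisors of members of |MP| (E_i + E'_i
~ MP, E'_i effective); for irreducible proper Z that kernel is the line of [Z] = the divisor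
monomial E_1...E_n up to multiplicity, so the statement says: BOUNDED DIVISOR MONOMIALS SPAN W_K
along the orbit. Implies X (DivisorialToGeneral). NOT implied by HC: it is a Diophantine statement
about the rank-3 Neron–Severi la -/
@[route_item "route-HodgeConjecture-DegreeSpectroscopy"]
def DivisorialDegreeBound : Prop :=
  ∀ (n m d t t' : ℕ), 1 ≤ n → 1 ≤ d → (∀ w₁ w₂ : ℂ, w₁ ^ 2 - ((2 * (m : ℤ) : ℤ) : ℂ) * w₁ + (((m : ℤ) ^ 2 + (d : ℤ) : ℤ) : ℂ) = 0 → w₂ ^ 2 - ((2 * (m : ℤ) : ℤ) : ℂ) * w₂ + (((m : ℤ) ^ 2 + (d : ℤ) : ℤ) : ℂ) = 0 → w₁ ≠ w₂ → ∀ j : ℕ, 0 < j → j ≤ 2 * n → w₁ ^ j ≠ w₂ ^ j) → ∃ M : ℕ, ∀ (B₀ : Literature.AlgebraicGeometry.Motives.AbelianVariety ℂ) (PB : Literature.AlgebraicGeometry.Motives.CartierDivisor B₀.X.left) [AlgebraicGeometry.IsDominant (Literature.AlgebraicGeometry.Motives.AbelianVariety.Hom.toSchemeHom (Literature.AlgebraicGeometry.Motives.AbelianVariety.fst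 B₀ B₀))] [AlgebraicGeometry.IsDominant (Literature.AlgebraicGeometry.Motives.AbelianVariety.Hom.toSchemeHom (Literature.AlgebraicGeometry.Motives.AbelianVariety.snd B₀ B₀))], B₀.dim = n → PB.IsAmple → PB.IsEffective → PB.h0 ℂ = t → ∀ (A : Literature.AlgebraicGeometry.Motives.AbelianVariety ℂ) (g : B₀.prod B₀ ⟶ A) (f : A ⟶ A) (P : Literature.AlgebraicGeometry.Motives.CartierDivisor A.X.left) (N : ℕ) [AlgebraicGeometry.IsDominant (Literature.AlgebraicGeometry.Motives.AbelianVariety.Hom.toSchemeHom g)], Literature.AlgebraicGeometry.Motives.AbelianVariety.IsIsogeny g → 1 ≤ N → CategoryTheory.CategoryStruct.comp (Literature.AlgebraicGeometry.Motives.AbelianVariety.prodLift ((m : ℤ) • Literature.AlgebraicGeometry.Motives.AbelianVariety.fst B₀ B₀ - ((d : ℕ) : ℤ) • Literature.AlgebraicGeometry.Motives.AbelianVariety.snd B₀ B₀) (Literature.AlgebraicGeometry.Motives.AbelianVariety.fst B₀ B₀ + (m : ℤ) • Literature.AlgebraicGeometry.Motives.AbelianVariety.snd B₀ B₀)) g =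 CategoryTheory.CategoryStruct.comp g f → P.IsAmple → P.IsEffective → P.h0 ℂ = t' → (P.pullback (Literature.AlgebraicGeometry.Motives.AbelianVariety.Hom.toSchemeHom g)).LinEquiv (N • (PB.pullback (Literature.AlgebraicGeometry.Motives.AbelianVariety.Hom.toSchemeHom (Literature.AlgebraicGeometry.Motives.AbelianVariety.fst B₀ B₀)) + (d) • PB.pullback (Literature.AlgebraicGeometry.Motives.AbelianVariety.Hom.toSchemeHom (Literature.AlgebraicGeometry.Motives.AbelianVariety.snd B₀ B₀)))) → ∀ c : Literature.AlgebraicTopology.SingularHomology.singularCohomology ℂ ℂ (Literature.AlgebraicGeometry.Motives.ComplexPoints (A).X) (2 * n), Literature.AlgebraicGeometry.HodgeTheory.IsRationalClass c → c ∈ ⨆ (w : ℂ) (_ : w ^ 2 - ((2 * (m : ℤ) : ℤ) : ℂ) * w + (((m : ℤ) ^ 2 + (d : ℤ) : ℤ) : ℂ) = 0), Module.End.eigenspace ((Literature.AlgebraicTopology.SingularHomology.singularCohomology.map ℂ ℂ (Literature.AlgebraicGeometry.Motives.AlgPoints.mapContinuous (L := ℂ) (f).hom.hom.hom) (2 * n)).hom)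 (w ^ (2 * n)) → c ∈ ⨆ (E : Fin (n) → Literature.AlgebraicGeometry.Motives.CartierDivisor (A).X.left) (E' : Fin (n) → Literature.AlgebraicGeometry.Motives.CartierDivisor (A).X.left) (_ : ∀ i, (E i).IsEffective ∧ (E' i).IsEffective ∧ (E i + E' i).LinEquiv (M • P)) (_ : ∀ z ∈ {z | ∀ i, ¬ (E i).Avoids z}, ((n : ℕ) : ℕ∞) ≤ Order.coheight z) (_ : IsIrreducible {z | ∀ i, ¬ (E i).Avoids z}), LinearMap.ker (Literature.AlgebraicGeometry.HodgeTheory.complexBetti.restrictCompl (A).X {z | ∀ i, ¬ (E i).Avoids z} (2 * n)).hom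

/-- item stmt-HodgeConjecture-3144 · crux · rank 4 · closed · moot by None · by planner
why it might fail: not-X: HC predicts it is false; X for n <= 3 holds non-effectively (fourfolds all K, split sixfolds: Markman 2025 + Baire), so a proof must live at n >= 4, where no lower-bound engine for RATIONAL classes exists (Debarre/EdGFS/matroidal degree bounds are integral or per-variety, silent on Q-spans).
sources: Markman2025SurveySecant §1.1, Thm 1.2 (arXiv:2509.23403), Zharkov2020TropicalWeil (arXiv:2002.02347: Kontsevich-Zharkov tropical counterexample search, inconclusive), arXiv:2507.15704 (matroids and the INTEGRAL Hodge conjecture for abelian varieties: degree lower bounds), doi:10.24033/bsmf.2236 (Debarre 1994, Degrees of curves in abelian varieties; arXiv:alg-geom/9210005), KollarTrento1992, Andre1996Motifs Thm 0.6.2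
[crux] NEGATIVE SIDE — the card's refutation branch, filed ranked so that it is staffed: for some
(n, m, d, t, t') the minimal degree of cycles spanning the Weil classes is UNBOUNDED along the
K-isogeny orbit of the split squares (literally not-X). With the Baire converse of the compactness
lemma this is equivalent to the failure of Weil-class algebraicity somewhere in that family, i.e. to
not-HodgeConjecture — a counterexample MECHANISM that never exhibits a non-algebraic class on a
single variety (it exhibits divergence along a tower), hence immune to the Galois/conjugation tests
(Deligne: Hodge classes on abelian varieties are absolute) and consistent with motivated-ness (Andre
1996; the price of success is not-B(X) for an auxiliary X, Andre 0.6.2). Engine ('low-degree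
rigidity at deep points'): lower bounds for the P-degree of effective cycles with non-zero Weil
component on (B0 x B0)/G in terms of |G| — restriction to the abelian subvarieties g(B0 x 0), g(0 x
B0) and their translates (where W restricts computably), Debarre-type degree inequalities for
subvarieties of abelian varieties, tropical/matroidal specialisation (Engel–de Gaay
Fortman–Schreieder, integral analogue), spe -/
@[route_item "route-HodgeConjecture-DegreeSpectroscopy"]
def IsogenyTowerDegreeGrowth : Prop :=
  ¬ HeckeOrbitDegreeBound

/-- item stmt-HodgeConjecture-3145 · support · rank 9 · closed · moot by None · by planner
sources: vanGeemen1994HodgeAV 6.12, GoodmanWallachGTM255 (FFT for Sp), LangeBirkenhake1992, VoisinHodgeI2002 Thm 11.30 (Lefschetz (1,1))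
[support] FREE ANCHORS. On B0 x B0 (any B0 of dimension n >= 1, no genericity) with the split
K-action fsplit = (x,y) |-> (m x - d y, x + m y), every RATIONAL class in the Weil eigen-part of
fsplit^* on H^{2n} lies in divisorClassesSpan (span of n-fold cup products of rational
(1,1)-classes): W_K = det H^1(B0) (x) K is invariant under SL(H^1(B0)) acting diagonally, and the
Sp(H^1(B0), psi)-invariants of H^*(B0 x B0, Q) = Lambda(H^1 + H^1) are generated by the three
degree-2 invariants psi_11, psi_22, psi_12 (first fundamental theorem for Sp in the skew-symmetric
setting), which are c_1 of fst^*L, snd^*L and m^*L - fst^*L - snd^*L for an ample L inducing psi —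
genuine divisor classes (Lefschetz (1,1)). Pure multilinear algebra + Lefschetz; sanity n = 1: W
inside NS(E x E)_Q = <E x 0, 0 x E, Delta>. This is why the orbit of the split locus is a FREE
anchor set; with isogeny transport (g^* ring isomorphism) it also shows W(A) inside D^n(A) at every
orbit point (used by DivisorialDegreeBound). -/
@[route_item "route-HodgeConjecture-DegreeSpectroscopy"]
def SplitSquareAnchors : Prop :=
  ∀ (n m d : ℕ) (B₀ : Literature.AlgebraicGeometry.Motives.AbelianVariety ℂ), 1 ≤ n → 1 ≤ d → (∀ w₁ w₂ : ℂ, w₁ ^ 2 - ((2 * (m : ℤ) : ℤ) : ℂ) * w₁ + (((m : ℤ) ^ 2 + (d : ℤ) : ℤ) : ℂ) = 0 → w₂ ^ 2 - ((2 * (m : ℤ) : ℤ) : ℂ) * w₂ + (((m : ℤ) ^ 2 + (d : ℤ) : ℤ) : ℂ) = 0 → w₁ ≠ w₂ → ∀ j : ℕ, 0 < j → j ≤ 2 * n → w₁ ^ j ≠ w₂ ^ j) → B₀.dim = n → ∀ c : Literature.AlgebraicTopology.SingularHomology.singularCohomology ℂ ℂ (Literature.AlgebraicGeometry.Motives.ComplexPoints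 (B₀.prod B₀).X) (2 * n), Literature.AlgebraicGeometry.HodgeTheory.IsRationalClass c → c ∈ ⨆ (w : ℂ) (_ : w ^ 2 - ((2 * (m : ℤ) : ℤ) : ℂ) * w + (((m : ℤ) ^ 2 + (d : ℤ) : ℤ) : ℂ) = 0), Module.End.eigenspace ((Literature.AlgebraicTopology.SingularHomology.singularCohomology.map ℂ ℂ (Literature.AlgebraicGeometry.Motives.AlgPoints.mapContinuous (L := ℂ) (Literature.AlgebraicGeometry.Motives.AbelianVariety.prodLift ((m : ℤ) • Literature.AlgebraicGeometry.Motives.AbelianVariety.fst B₀ B₀ - ((d : ℕ) : ℤ) • Literature.AlgebraicGeometry.Motives.AbelianVariety.snd B₀ B₀) (Literature.AlgebraicGeometry.Motives.AbelianVariety.fst B₀ B₀ + (m : ℤ) • Literature.AlgebraicGeometry.Motives.AbelianVariety.snd B₀ B₀)).hom.hom.hom) (2 * n)).hom) (w ^ (2 * n)) → c ∈ Literature.Barriers.HodgeConjecture.divisorClassesSpan (B₀.prod B₀).X (2 * n) n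

/-- item stmt-HodgeConjecture-3146 · support · rank 9 · closed · moot by None · by planner
sources: vanGeemen1994HodgeAV §5-6, LangeBirkenhake1992 (Lefschetz theorem 3Theta very ample; Riemann-Roch h^0 = sqrt(deg)), Mumford1966, GoodmanWallachGTM255
[support] UNIFORM DEGREE AT THE ANCHORS = X at depth N = 1 (g = id): there is M0 = M0(n,m,d,t) with
the rational Weil classes of (B0 x B0, fsplit) inside the bounded-|k Theta0| span for all B0 and all
effective ample P_B with h^0 = t. Proof sketch (known mathematics): by SplitSquareAnchors W_K is
spanned by divisor monomials theta1^a theta2^b nu^c (nu = m^*theta), represented by proper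
intersections of general translates, whose Theta0-degree is a universal polynomial in (n, d,
intersection numbers of P_B) hence bounded in terms of (n,d,t); a subvariety of bounded degree is a
component of a proper intersection of n members of |k Theta0| with k <= 3^{n+1} deg (3 Theta0 very
ample — Lefschetz; Mumford's set-theoretic generation by degree-deg hypersurfaces; Bertini outside
the base locus). First milestone for the typed vocabulary of X; grounders: check cofinality of the
|kP|-complexity with P-degree here. -/
@[route_item "route-HodgeConjecture-DegreeSpectroscopy"]
def SplitSquareAnchorsBounded : Prop :=
  ∀ (n m d t : ℕ), 1 ≤ n → 1 ≤ d → (∀ w₁ w₂ : ℂ, w₁ ^ 2 - ((2 * (m : ℤ) : ℤ) : ℂ) * w₁ + (((m : ℤ) ^ 2 + (d : ℤ) : ℤ) : ℂ) = 0 → w₂ ^ 2 - ((2 * (m : ℤ) : ℤ) : ℂ) * w₂ + (((m : ℤ) ^ 2 + (d : ℤ) : ℤ) : ℂ) = 0 → w₁ ≠ w₂ → ∀ j : ℕ, 0 < j → j ≤ 2 * n → w₁ ^ j ≠ w₂ ^ j) → ∃ M : ℕ, ∀ (B₀ : Literature.AlgebraicGeometry.Motives.AbelianVariety ℂ) (PB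 : Literature.AlgebraicGeometry.Motives.CartierDivisor B₀.X.left) [AlgebraicGeometry.IsDominant (Literature.AlgebraicGeometry.Motives.AbelianVariety.Hom.toSchemeHom (Literature.AlgebraicGeometry.Motives.AbelianVariety.fst B₀ B₀))] [AlgebraicGeometry.IsDominant (Literature.AlgebraicGeometry.Motives.AbelianVariety.Hom.toSchemeHom (Literature.AlgebraicGeometry.Motives.AbelianVariety.snd B₀ B₀))], B₀.dim = n → PB.IsAmple → PB.IsEffective → PB.h0 ℂ = t → ∀ c : Literature.AlgebraicTopology.SingularHomology.singularCohomology ℂ ℂ (Literature.AlgebraicGeometry.Motives.ComplexPoints (B₀.prod B₀).X) (2 * n), Literature.AlgebraicGeometry.HodgeTheory.IsRationalClass c → c ∈ ⨆ (w : ℂ) (_ : w ^ 2 - ((2 * (m : ℤ) : ℤ) : ℂ) * w + (((m : ℤ) ^ 2 + (d : ℤ) : ℤ) : ℂ) = 0), Module.End.eigenspace ((Literature.AlgebraicTopology.SingularHomology.singularCohomology.map ℂ ℂ (Literature.AlgebraicGeometry.Motives.AlgPoints.mapContinuous (L := ℂ) (Literature.AlgebraicGeometry.Motives.AbelianVariety.prodLift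 ((m : ℤ) • Literature.AlgebraicGeometry.Motives.AbelianVariety.fst B₀ B₀ - ((d : ℕ) : ℤ) • Literature.AlgebraicGeometry.Motives.AbelianVariety.snd B₀ B₀) (Literature.AlgebraicGeometry.Motives.AbelianVariety.fst B₀ B₀ + (m : ℤ) • Literature.AlgebraicGeometry.Motives.AbelianVariety.snd B₀ B₀)).hom.hom.hom) (2 * n)).hom) (w ^ (2 * n)) → c ∈ ⨆ (D : Fin (n) → Literature.AlgebraicGeometry.Motives.CartierDivisor (B₀.prod B₀).X.left) (_ : ∀ i, (D i).IsEffective ∧ ∃ k : ℕ, k ≤ M ∧ (D i).LinEquiv (k • (PB.pullback (Literature.AlgebraicGeometry.Motives.AbelianVariety.Hom.toSchemeHom (Literature.AlgebraicGeometry.Motives.AbelianVariety.fst B₀ B₀)) + (d) • PB.pullback (Literature.AlgebraicGeometry.Motives.AbelianVariety.Hom.toSchemeHom (Literature.AlgebraicGeometry.Motives.AbelianVariety.snd B₀ B₀))))) (_ : ∀ z ∈ {z | ∀ i, ¬ (D i).Avoids z}, ((n : ℕ) : ℕ∞) ≤ Order.coheight z), LinearMap.ker (Literature.AlgebraicGeometry.HodgeTheory.complexBetti.restrictCompl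 (B₀.prod B₀).X {z | ∀ i, ¬ (D i).Avoids z} (2 * n)).hom

/-- item stmt-HodgeConjecture-3147 · support · rank 9 · closed · moot by None · by planner
sources: vanGeemen1994HodgeAV 5.12, Thm 4.15, 4.16, Markman2025SurveySecant Thm 1.2 (arXiv:2509.23403), Markman2025SecantWeil (arXiv:2502.03415)
[support] CALIBRATION n = 2 (dimension 4): X with n = 2 holds NON-effectively. Orbit points are
abelian fourfolds of Weil type (split discriminant 1) whose Weil classes are algebraic for every K
(Markman, generalized Kummers; Q(sqrt(-3)), Q(i): Schoen, van Geemen's theta fourfolds 5.12; now all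
discriminants: Markman2025SurveySecant Thm 1.2), so S = union over B of the closed loci D_B and
Baire on each of the finitely many components with h^0 = t' gives one M. The EFFECTIVE value of M at
the first deep points of the Q(i), delta = 1 family (explicit surfaces B0, explicit isogenies of
degree p^k; van Geemen's theta cycles, Markman's secant-sheaf cycles with computable support
degrees) is the card's computation G3 — the data from which a uniform construction for n >= 4 is to
be guessed and against which every NEG lower-bound technique must be tested (it must NOT diverge
here). Attach kit jobs / certified computations to this item (evidence kind computation). -/
@[route_item "route-HodgeConjecture-DegreeSpectroscopy"]
def FourfoldOrbitBound : Prop :=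
  ∀ (m d t t' : ℕ), 1 ≤ d → (∀ w₁ w₂ : ℂ, w₁ ^ 2 - ((2 * (m : ℤ) : ℤ) : ℂ) * w₁ + (((m : ℤ) ^ 2 + (d : ℤ) : ℤ) : ℂ) = 0 → w₂ ^ 2 - ((2 * (m : ℤ) : ℤ) : ℂ) * w₂ + (((m : ℤ) ^ 2 + (d : ℤ) : ℤ) : ℂ) = 0 → w₁ ≠ w₂ → ∀ j : ℕ, 0 < j → j ≤ 2 * 2 → w₁ ^ j ≠ w₂ ^ j) → ∃ M : ℕ, ∀ (B₀ : Literature.AlgebraicGeometry.Motives.AbelianVariety ℂ) (PB : Literature.AlgebraicGeometry.Motives.CartierDivisor B₀.X.left) [AlgebraicGeometry.IsDominant (Literature.AlgebraicGeometry.Motives.AbelianVariety.Hom.toSchemeHom (Literature.AlgebraicGeometry.Motives.AbelianVariety.fst B₀ B₀))] [AlgebraicGeometry.IsDominant (Literature.AlgebraicGeometry.Motives.AbelianVariety.Hom.toSchemeHom (Literature.AlgebraicGeometry.Motives.AbelianVariety.snd B₀ B₀))], B₀.dim = 2 → PB.IsAmple → PB.IsEffective → PB.h0 ℂ = t → ∀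 (A : Literature.AlgebraicGeometry.Motives.AbelianVariety ℂ) (g : B₀.prod B₀ ⟶ A) (f : A ⟶ A) (P : Literature.AlgebraicGeometry.Motives.CartierDivisor A.X.left) (N : ℕ) [AlgebraicGeometry.IsDominant (Literature.AlgebraicGeometry.Motives.AbelianVariety.Hom.toSchemeHom g)], Literature.AlgebraicGeometry.Motives.AbelianVariety.IsIsogeny g → 1 ≤ N → CategoryTheory.CategoryStruct.comp (Literature.AlgebraicGeometry.Motives.AbelianVariety.prodLift ((m : ℤ) • Literature.AlgebraicGeometry.Motives.AbelianVariety.fst B₀ B₀ - ((d : ℕ) : ℤ) • Literature.AlgebraicGeometry.Motives.AbelianVariety.snd B₀ B₀) (Literature.AlgebraicGeometry.Motives.AbelianVariety.fst B₀ B₀ + (m : ℤ) • Literature.AlgebraicGeometry.Motives.AbelianVariety.snd B₀ B₀)) g = CategoryTheory.CategoryStruct.comp g f → P.IsAmple → P.IsEffective → P.h0 ℂ = t' → (P.pullback (Literature.AlgebraicGeometry.Motives.AbelianVariety.Hom.toSchemeHom g)).LinEquiv (N • (PB.pullback (Literature.AlgebraicGeometry.Motives.AbelianVariety.Hom.toSchemeHom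 (Literature.AlgebraicGeometry.Motives.AbelianVariety.fst B₀ B₀)) + (d) • PB.pullback (Literature.AlgebraicGeometry.Motives.AbelianVariety.Hom.toSchemeHom (Literature.AlgebraicGeometry.Motives.AbelianVariety.snd B₀ B₀)))) → ∀ c : Literature.AlgebraicTopology.SingularHomology.singularCohomology ℂ ℂ (Literature.AlgebraicGeometry.Motives.ComplexPoints (A).X) (2 * 2), Literature.AlgebraicGeometry.HodgeTheory.IsRationalClass c → c ∈ ⨆ (w : ℂ) (_ : w ^ 2 - ((2 * (m : ℤ) : ℤ) : ℂ) * w + (((m : ℤ) ^ 2 + (d : ℤ) : ℤ) : ℂ) = 0), Module.End.eigenspace ((Literature.AlgebraicTopology.SingularHomology.singularCohomology.map ℂ ℂ (Literature.AlgebraicGeometry.Motives.AlgPoints.mapContinuous (L := ℂ) (f).hom.hom.hom) (2 * 2)).hom) (w ^ (2 * 2)) → c ∈ ⨆ (D : Fin (2) → Literature.AlgebraicGeometry.Motives.CartierDivisor (A).X.left) (_ : ∀ i, (D i).IsEffective ∧ ∃ k : ℕ, k ≤ M ∧ (D i).LinEquiv (k • P)) (_ : ∀ z ∈ {z | ∀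 i, ¬ (D i).Avoids z}, ((2 : ℕ) : ℕ∞) ≤ Order.coheight z), LinearMap.ker (Literature.AlgebraicGeometry.HodgeTheory.complexBetti.restrictCompl (A).X {z | ∀ i, ¬ (D i).Avoids z} (2 * 2)).hom

/-- item stmt-HodgeConjecture-3148 · support · rank 9 · closed · moot by None · by planner
sources: Mumford1966, LangeBirkenhake1992, vanGeemen1994HodgeAV
[support] glue r3 -> r2: an irreducible proper intersection Z of n sub-|MP| effective divisors has
P-degree <= (MP)^n . P^n / ... bounded in (M, n, t'), hence is a component of a proper intersection
of n members of |kP| with k <= M'(M, n, t') (very ampleness of 3P, Mumford's set-theoretic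
generation by degree-deg hypersurface sections, Bertini), so the kernel for Z lies in the X-span
with M'. Known-mathematics glue; also the place to record the exact cofinality constants between the
two typed complexity measures and the P-degree. -/
@[route_item "route-HodgeConjecture-DegreeSpectroscopy"]
def DivisorialToGeneral : Prop :=
  DivisorialDegreeBound → HeckeOrbitDegreeBound

/-- item stmt-HodgeConjecture-3149 · support · rank 9 · closed · moot by None · by planner
sources: vanGeemen1994HodgeAV 5.12, §7, LangeBirkenhake1992, arXiv:2308.13913
[support] negative side of r3 (not-DivisorialDegreeBound): for some data, bounded divisor monomials
do NOT span the Weil line along the orbit. Expected TRUE and provable without touching HC, by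
lattice arithmetic: compute NS(A) with its Sym^{2n} intersection form and the line W along an
explicit tower (B0 x B0)/G_k (first n = 1: surfaces isogenous to E x E and ternary quadratic forms;
then van Geemen's Q(i) fourfold family 5.12) and show the minimal P-degree of effective sub-|MP|
monomial representatives diverges. Its proof tells the POS side that deep bounded cycles must be
non-divisorial; its failure would make r3 (hence the target) a theorem of arithmetic. Cheap,
decisive first experiment of the route (kit-able). -/
@[route_item "route-HodgeConjecture-DegreeSpectroscopy"]
def DivisorialDegreeGrowth : Prop :=
  ¬ DivisorialDegreeBound

/-- item stmt-HodgeConjecture-3150 · support · rank 9 · closed · moot by None · by planner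
sources: CattaniDeligneKaplan1995JAMS, vanGeemen1994HodgeAV §5, 4.14, Markman2025SurveySecant §11.5 Steps 1-2 (arXiv:2509.23403), Deligne1982HodgeCycles §4-5, CharlesSchnell2014Notes Thm 11.5.24, VoisinHodgeII2003 §5.3 (Hodge loci)
[support] glue X -> target (each ingredient in print; expected to be restated with named-fact
hypotheses as they are vendored): (i) COMPACTNESS: for the universal family over a component S of
the moduli of polarized abelian varieties of Weil type (fine level) and its flat rank-2 local system
of Weil classes, the locus D_M = {s : W_s inside the bounded-|kP_s| span} is Zariski closed — proper
relative Chow/Hilbert schemes of bounded degree, local constancy of cycle classes in flat families,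
flat sub-local-systems compared on path-connected components (Voisin, Hodge loci;
CattaniDeligneKaplan1995JAMS for algebraicity of S); D_M containing a Zariski-dense set forces D_M =
S. (ii) DENSITY/CONNECTIVITY: components of the Weil moduli with the same (K, n, discriminant)
parametrise K-isogenous varieties (vanGeemen1994HodgeAV §5; Markman2025SurveySecant §11.5 Step 1);
split squares have discriminant (-1)^n = the split class (Deligne–Milne; Markman §11.5), U(n,n)(Q)
is dense in U(n,n)(R) (real approximation), so the K-isogeny orbit of {B0 x B0 : B0 generic} is
Zariski dense in every component of every split-discriminant family; every K-isogeny g from a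
generic square and K-compatible P satisf -/
@[route_item "route-HodgeConjecture-DegreeSpectroscopy"]
def HeckeOrbitGlue : Prop :=
  HeckeOrbitDegreeBound → WeilClassesAlgebraic

/-- item stmt-HodgeConjecture-3151 · assembly · rank 1 · closed · moot by None · by planner
sources: CharlesSchnell2014Notes Thm 11.5.21 (Andre), Markman2025SurveySecant Thm 1.4
[assembly] modus ponens: X (HeckeOrbitDegreeBound) and the glue HeckeOrbitGlue give the sector
target WeilClassesAlgebraic. SECTOR ROUTE: the assembly deliberately ends at Weil's 1977 problem
(all imaginary quadratic K, all 2n, all discriminants); no claim X -> HodgeConjecture is made (frame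
#1 absent by design). Upgrades recorded under NOT DECOMPOSED YET: the CM-field version of X +
Andre's theorem would give HC for CM abelian varieties; a second application of compactness along CM
points of arbitrary Hodge loci in A_g would give HC for all abelian varieties. -/
@[route_item "route-HodgeConjecture-DegreeSpectroscopy"]
def Assembly : Prop :=
  HeckeOrbitDegreeBound → HeckeOrbitGlue → WeilClassesAlgebraic

end Summit.HodgeConjecture.HodgeConjecture.Theses.DegreeSpectroscopy
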